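import Mathlib
import HarnessLib
import Summits.ResolutionOfSingularities.ResolutionOfSingularities.Theorems.WildQuotientsWildQuotientResolutionS1aOneShotKillChart
import Summits.ResolutionOfSingularities.ResolutionOfSingularities.Theorems.WildQuotientsWildQuotientResolutionS1aOneShotKillShift

/-!
# S1a — (T2 v3, chart form) ONE-SHOT KILL with OLD BOUNDARY `ε` and GENERAL SHIFT `δ` on the chart rings of the move

[OURS · L1 W4.5c · lead-1 g6; plan-1 SIG v3 `W45cT2Signatures.lean` c87cfa39393726bf «GENERAL WEIGHTS», memo §8/§10] — NOT a
statement of the manuscript; counted 0; AI-level work, weaker than expert review. Crux stmt-ResolutionOfSingularities-17941, line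
`s1a-logminvertex` v6, stub `stub_winningStrategy` ((R0) branch, rule of record = θ-homogeneity with shift).

Boundary form of `…S1aOneShotKillChart`: the node carries an old boundary monomial `ε ∈ B` with `σ − 1 = ε·θ`, `θ` raising the
weight by `δ` (`θ y ∈ K δ`, `θ f_i ∈ K (w_i + δ)`); relations: BOTTOM generators (`w_i = δ`) and HIT generators
(`θ f_h ≡ u f_i^k mod K (w_h + δ + 1)`, `k w_i = w_h + δ`, `u` a unit mod `K 1`). Then on every chart ring `R^w[(bT^d)⁻¹]`
(`b ∈ K d` σ-invariant, `d ≥ 1`) the transported automorphism satisfies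
**`augmentationIdeal σʼ = (ε · s^δ)`** (`augmentationIdeal_sigmaChart_eq_span_shift`) — principal: Király–Lütkebohmert KILL with
new boundary `ε s`. Ingredients: `sigmaR_sub_mem_span_shift` / `sigmaChart_sub_mem_span_shift` (gr-shift on `R^w` and on the
chart, induction on generators), `unitSuccessorFormula_shift` (cancel `e^{w_h}`), and (T2a v3) `augmentationIdeal_eq_span_of_oneShot_shift`.
-/

set_option linter.dupNamespace false

noncomputable section

open LaurentPolynomial
open Literature.AlgebraicGeometry.Resolution
open Summit.ResolutionOfSingularities.ResolutionOfSingularities.Theorems.WildQuotientResolution.S1.CoarseChart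

namespace Summit.ResolutionOfSingularities.ResolutionOfSingularities.Theorems.WildQuotientResolution.S1.OneShotKill

universe u v

/-! ## The abstract hit relation with shift -/

section Abstract

variable {B C : Type u} [CommRing B] [CommRing C] [Algebra B C] (σ : B ≃+* B) (τ : C ≃+* C)
  {ι : Type v} (f : ι → B) (w : ι → ℕ) (g : ι → C) (e : C)

/-- **(T2c v3) HIT FORMULA with shift**: `σ f_h − f_h − ε u f_i^k = ε t`, `t ∈ K (w_h + δ + 1)`, `k w_i = w_h + δ` descend to
`τ g_h − g_h − ε u g_i^k e^δ ∈ (ε e^{δ+1})` in a chart ring with `f_j ↦ g_j e^{w_j}`, `K n ↦ (eⁿ)`, `e` a `τ`-fixed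
non-zero-divisor. [OURS · L1 W4.5c] -/
theorem unitSuccessorFormula_shift (hcompat : ∀ b : B, τ (algebraMap B C b) = algebraMap B C (σ b))
    (he : e ∈ nonZeroDivisors C) (hτe : τ e = e) (hfg : ∀ j, algebraMap B C (f j) = g j * e ^ (w j))
    (hK : ∀ (n : ℕ) (y : B), y ∈ (weightedFiltration f w).ideal n → algebraMap B C y ∈ Ideal.span {e ^ n})
    (ε : B) (δ : ℕ) (h i : ι) (u : B) (k : ℕ) (hk : k * w i = w h + δ)
    (t : B) (ht : t ∈ (weightedFiltration f w).ideal (w h + δ + 1)) (hrel : σ (f h) - f h - ε * u * f i ^ k = ε * t) :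
    τ (g h) - g h - algebraMap B C ε * algebraMap B C u * g i ^ k * e ^ δ ∈
      Ideal.span {algebraMap B C ε * e ^ (δ + 1)} := by
  obtain ⟨z, hz⟩ := Ideal.mem_span_singleton'.mp (hK _ _ ht)
  -- `hz : z * e ^ (w h + δ + 1) = algebraMap t`
  have hrel' := congrArg (algebraMap B C) hrel
  rw [map_sub, map_sub, ← hcompat] at hrel'
  simp only [map_mul, map_pow, hfg, hτe] at hrel'
  rw [← hz] at hrel'
  refine Ideal.mem_span_singleton'.mpr ⟨z, ?_⟩
  have hewh : e ^ w h ∈ nonZeroDivisors C := pow_mem he (w h)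
  refine (mul_cancel_right_mem_nonZeroDivisors hewh).mp ?_
  have e1 : (g i * e ^ w i) ^ k = g i ^ k * (e ^ δ * e ^ w h) := by
    rw [mul_pow, ← pow_mul, mul_comm (w i) k, hk, pow_add, mul_comm (e ^ w h)]
  rw [e1] at hrel'
  have e2 : e ^ (w h + δ + 1) = e ^ (δ + 1) * e ^ w h := by rw [← pow_add]; ring_nf
  rw [e2] at hrel'
  linear_combination -hrel'

end Abstract

/-! ## gr-shift on `R^w` and on the chart ring; the chart theorem -/

section Chart

variable {ι : Type v} [AddCommGroup ι] [DecidableEq ι] {B : Type u} [CommRing B]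
  (𝒜 : ι → AddSubgroup B) [GradedRing 𝒜] {c : ℕ} (f : Fin c → B) (w : Fin c → ℕ)
  (d : ℕ) (b : ↥(𝒜 0)) (hb : b ∈ (traceFiltration 𝒜 f w).ideal d) (σ : B ≃+* B)
  (hσJ : ∀ n : ℕ, ((weightedFiltration f w).ideal n).map (σ : B →+* B) ≤ (weightedFiltration f w).ideal n)
  {p : ℕ} (hp : 0 < p) (hσp : ∀ x : B, (⇑σ)^[p] x = x) (hσb : σ (b : B) = b) (ε : B) (δ : ℕ)

include hσJ hp hσp in
/-- **gr-SHIFT on `R^w`**: if `σ y − y ∈ ε·K δ` for all `y` and `σ f_i − f_i ∈ ε·K (w_i + δ)`, then `σ_R z − z ∈ (ε s^δ)`. -/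
theorem sigmaR_sub_mem_span_shift (h1 : ∀ y : B, ∃ t ∈ (weightedFiltration f w).ideal δ, σ y - y = ε * t)
    (hdepth : ∀ i, ∃ t ∈ (weightedFiltration f w).ideal (w i + δ), σ (f i) - f i = ε * t)
    (z : ↥(cobordantAlgebra f w)) :
    sigmaR σ f w hσJ hp hσp z - z ∈
      Ideal.span {algebraMap B (↥(cobordantAlgebra f w)) ε * cobordantAlgebra.s f w ^ δ} := by
  induction z using cobordantAlgebra.induction_on with
  | algebraMap a =>
    obtain ⟨t, ht, hat⟩ := h1 a
    rw [sigmaR_algebraMap, ← map_sub, hat, map_mul, algebraMap_eq_CT_mul_s_pow f w ht]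
    exact Ideal.mem_span_singleton'.mpr ⟨⟨_, C_mul_T_mem_cobordantAlgebra f w ht⟩, by ring⟩
  | s => rw [sigmaR_s, sub_self]; exact Ideal.zero_mem _
  | u' i =>
    obtain ⟨t, ht, hit⟩ := hdepth i
    have hmem : C t * T ((w i : ℤ) + δ) ∈ cobordantAlgebra f w := by
      have := C_mul_T_mem_cobordantAlgebra f w ht; exact_mod_cast this
    have key : sigmaR σ f w hσJ hp hσp (cobordantAlgebra.u' f w i) - cobordantAlgebra.u' f w i =
        (⟨_, hmem⟩ : ↥(cobordantAlgebra f w)) *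
          (algebraMap B (↥(cobordantAlgebra f w)) ε * cobordantAlgebra.s f w ^ δ) := by
      apply Subtype.ext
      rw [AddSubgroupClass.coe_sub, MulMemClass.coe_mul, MulMemClass.coe_mul, cobordantAlgebra.coe_s_pow,
        cobordantAlgebra.coe_algebraMap, u'_eq, sigmaR_mk]
      show C (σ (f i)) * T (w i : ℤ) - C (f i) * T (w i : ℤ) = C t * T ((w i : ℤ) + δ) * (C ε * T (-(δ : ℤ)))
      rw [← sub_mul, ← map_sub, hit, map_mul]
      rw [show C t * T ((w i : ℤ) + δ) * (C ε * T (-(δ : ℤ))) = C ε * C t * (T ((w i : ℤ) + δ) * T (-(δ : ℤ))) by ring,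
        ← T_add, add_neg_cancel_right, mul_assoc]
    rw [key]
    exact Ideal.mul_mem_left _ _ (Ideal.mem_span_singleton_self _)
  | add z₁ z₂ h₁ h₂ =>
    have : sigmaR σ f w hσJ hp hσp (z₁ + z₂) - (z₁ + z₂) =
        (sigmaR σ f w hσJ hp hσp z₁ - z₁) + (sigmaR σ f w hσJ hp hσp z₂ - z₂) := by rw [map_add]; ring
    rw [this]; exact Ideal.add_mem _ h₁ h₂
  | mul z₁ z₂ h₁ h₂ =>
    have : sigmaR σ f w hσJ hp hσp (z₁ * z₂) - z₁ * z₂ =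
        sigmaR σ f w hσJ hp hσp z₁ * (sigmaR σ f w hσJ hp hσp z₂ - z₂) + (sigmaR σ f w hσJ hp hσp z₁ - z₁) * z₂ := by
      rw [map_mul]; ring
    rw [this]; exact Ideal.add_mem _ (Ideal.mul_mem_left _ _ h₂) (Ideal.mul_mem_right _ _ h₁)

include hp hσp in
/-- **gr-SHIFT on the chart ring**: `σʼ x − x ∈ (ε s^δ)`. -/
theorem sigmaChart_sub_mem_span_shift (h1 : ∀ y : B, ∃ t ∈ (weightedFiltration f w).ideal δ, σ y - y = ε * t)
    (hdepth : ∀ i, ∃ t ∈ (weightedFiltration f w).ideal (w i + δ), σ (f i) - f i = ε * t)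
    (x : ChartRing 𝒜 f w d b hb) :
    sigmaChart 𝒜 f w d b hb σ hσJ hp hσp hσb x - x ∈
      Ideal.span {algebraMap _ (ChartRing 𝒜 f w d b hb) (algebraMap B (↥(cobordantAlgebra f w)) ε) *
        algebraMap _ (ChartRing 𝒜 f w d b hb) (cobordantAlgebra.s f w) ^ δ} := by
  obtain ⟨z, ⟨_, k, rfl⟩, hx⟩ := IsLocalization.exists_mk'_eq (Submonoid.powers (coverElement 𝒜 f w d b hb)) x
  have hU : IsUnit (algebraMap _ (ChartRing 𝒜 f w d b hb) (coverElement 𝒜 f w d b hb ^ k)) := by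
    rw [map_pow]; exact (IsLocalization.Away.algebraMap_isUnit (coverElement 𝒜 f w d b hb)).pow k
  have h1' : x * algebraMap _ (ChartRing 𝒜 f w d b hb) (coverElement 𝒜 f w d b hb ^ k) = algebraMap _ _ z := by
    rw [← hx]; exact IsLocalization.mk'_spec _ _ _
  have h2 : sigmaChart 𝒜 f w d b hb σ hσJ hp hσp hσb x *
      algebraMap _ (ChartRing 𝒜 f w d b hb) (coverElement 𝒜 f w d b hb ^ k) =
      algebraMap _ _ (sigmaR σ f w hσJ hp hσp z) := by
    have := congrArg (sigmaChart 𝒜 f w d b hb σ hσJ hp hσp hσb) h1'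
    rw [map_mul, sigmaChart_algebraMap, sigmaChart_algebraMap, map_pow,
      sigmaR_coverElement 𝒜 f w d b hb σ hσJ hp hσp hσb] at this
    exact this
  have h3 : (sigmaChart 𝒜 f w d b hb σ hσJ hp hσp hσb x - x) *
      algebraMap _ (ChartRing 𝒜 f w d b hb) (coverElement 𝒜 f w d b hb ^ k) =
      algebraMap _ _ (sigmaR σ f w hσJ hp hσp z - z) := by rw [sub_mul, h1', h2, map_sub]
  obtain ⟨z', hz'⟩ := Ideal.mem_span_singleton'.mp (sigmaR_sub_mem_span_shift f w σ hσJ hp hσp ε δ h1 hdepth z)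
  rw [← Ideal.mul_unit_mem_iff_mem _ hU, h3, ← hz', map_mul, map_mul, map_pow]
  exact Ideal.mul_mem_left _ _ (Ideal.mem_span_singleton_self _)

include hp hσp in
/-- **(T2 v3, chart form) ONE-SHOT KILL with old boundary `ε` and shift `δ`** on `R^w[(bT^d)⁻¹]`:
`augmentationIdeal σʼ = (ε s^δ)`. Hypotheses: `δ ≤ w_i`, `1 ≤ d`; `ε f_i ∈ I_σ` (centre inside the residual ideal);
gr-shift data `σ y − y ∈ ε K δ` (all `y`) and `σ f_i − f_i ∈ ε K (w_i + δ)`; every `i` BOTTOM (`w_i = δ`) or HIT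
(`σ f_h − f_h − ε u f_i^k ∈ ε K (w_h + δ + 1)`, `k w_i = w_h + δ`, `0 < k`, `u` a unit mod `K 1`). [OURS · L1 W4.5c] -/
theorem augmentationIdeal_sigmaChart_eq_span_shift (hw : ∀ i, δ ≤ w i) (hd : 1 ≤ d)
    (hεf : ∀ i, ε * f i ∈ augmentationIdeal σ)
    (h1 : ∀ y : B, ∃ t ∈ (weightedFiltration f w).ideal δ, σ y - y = ε * t)
    (hdepth : ∀ i, ∃ t ∈ (weightedFiltration f w).ideal (w i + δ), σ (f i) - f i = ε * t)
    (hrel : ∀ i, w i = δ ∨ ∃ (h : Fin c) (u : B) (k : ℕ), 0 < k ∧ k * w i = w h + δ ∧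
      IsUnit (Ideal.Quotient.mk ((weightedFiltration f w).ideal 1) u) ∧
      ∃ t ∈ (weightedFiltration f w).ideal (w h + δ + 1), σ (f h) - f h - ε * u * f i ^ k = ε * t) :
    augmentationIdeal (sigmaChart 𝒜 f w d b hb σ hσJ hp hσp hσb) =
      Ideal.span {algebraMap _ (ChartRing 𝒜 f w d b hb) (algebraMap B (↥(cobordantAlgebra f w)) ε) *
        algebraMap _ (ChartRing 𝒜 f w d b hb) (cobordantAlgebra.s f w) ^ δ} := by
  letI : Algebra B (ChartRing 𝒜 f w d b hb) :=
    ((algebraMap _ (ChartRing 𝒜 f w d b hb)).comp (algebraMap B (↥(cobordantAlgebra f w)))).toAlgebra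
  have halg : ∀ y : B, algebraMap B (ChartRing 𝒜 f w d b hb) y =
      algebraMap _ (ChartRing 𝒜 f w d b hb) (algebraMap B (↥(cobordantAlgebra f w)) y) := fun _ => rfl
  have hcompat : ∀ y : B, sigmaChart 𝒜 f w d b hb σ hσJ hp hσp hσb (algebraMap B (ChartRing 𝒜 f w d b hb) y) =
      algebraMap B (ChartRing 𝒜 f w d b hb) (σ y) := fun y => by
    rw [halg, halg]; exact sigmaChart_algebraMap_algebraMap 𝒜 f w d b hb σ hσJ hp hσp hσb y
  have hfg : ∀ j, algebraMap B (ChartRing 𝒜 f w d b hb) (f j) =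
      algebraMap _ (ChartRing 𝒜 f w d b hb) (cobordantAlgebra.u' f w j) *
        algebraMap _ (ChartRing 𝒜 f w d b hb) (cobordantAlgebra.s f w) ^ (w j) := fun j => by
    rw [halg, cobordantAlgebra.algebraMap_u, map_mul, map_pow, mul_comm]
  have hK : ∀ (n : ℕ) (y : B), y ∈ (weightedFiltration f w).ideal n →
      algebraMap B (ChartRing 𝒜 f w d b hb) y ∈
        Ideal.span {algebraMap _ (ChartRing 𝒜 f w d b hb) (cobordantAlgebra.s f w) ^ n} := fun n y hy => by
    rw [halg, ← map_pow]
    have := Ideal.mem_map_of_mem (algebraMap _ (ChartRing 𝒜 f w d b hb)) (algebraMap_mem_span_s_pow f w hy)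
    rwa [Ideal.map_span, Set.image_singleton] at this
  rw [← halg ε]
  refine augmentationIdeal_eq_span_of_oneShot_shift σ (sigmaChart 𝒜 f w d b hb σ hσJ hp hσp hσb) hcompat
    (fun i => algebraMap _ (ChartRing 𝒜 f w d b hb) (cobordantAlgebra.u' f w i)) w δ (algebraMap B _ ε)
    (algebraMap _ (ChartRing 𝒜 f w d b hb) (cobordantAlgebra.s f w))
    (span_algebraMap_u'_eq_top 𝒜 f w d b hb hd) (fun i => ⟨hw i, ?_⟩) ?_ fun i => ?_
  · -- `ε g_i e^{w_i} = ε f_i ∈ I_σ`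
    have : algebraMap B (ChartRing 𝒜 f w d b hb) ε *
        algebraMap _ (ChartRing 𝒜 f w d b hb) (cobordantAlgebra.u' f w i) *
        algebraMap _ (ChartRing 𝒜 f w d b hb) (cobordantAlgebra.s f w) ^ (w i) =
        algebraMap B (ChartRing 𝒜 f w d b hb) (ε * f i) := by rw [map_mul, hfg i, mul_assoc]
    rw [this]; exact Ideal.mem_map_of_mem _ (hεf i)
  · -- gr-shift on the chart
    intro x
    have := sigmaChart_sub_mem_span_shift 𝒜 f w d b hb σ hσJ hp hσp hσb ε δ h1 hdepth x
    rwa [← halg] at this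
  · rcases hrel i with hbot | ⟨h, u, k, hk, hkw, hu, t, ht, hrel'⟩
    · exact Or.inl hbot
    · refine Or.inr ⟨h, algebraMap B _ u, k, hk,
        isUnit_mk_span_of_isUnit_mk f w (algebraMap _ (ChartRing 𝒜 f w d b hb) (cobordantAlgebra.s f w)) hK hu, ?_⟩
      exact unitSuccessorFormula_shift σ (sigmaChart 𝒜 f w d b hb σ hσJ hp hσp hσb) f w
        (fun i => algebraMap _ (ChartRing 𝒜 f w d b hb) (cobordantAlgebra.u' f w i))
        (algebraMap _ (ChartRing 𝒜 f w d b hb) (cobordantAlgebra.s f w)) hcompat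
        (algebraMap_s_mem_nonZeroDivisors 𝒜 f w d b hb) (sigmaChart_s 𝒜 f w d b hb σ hσJ hp hσp hσb)
        hfg hK ε δ h i u k hkw t ht hrel'

end Chart

end Summit.ResolutionOfSingularities.ResolutionOfSingularities.Theorems.WildQuotientResolution.S1.OneShotKill

end
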